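import Mathlib
import Summits.CriticalPhenomena.SAWScalingLimit.Theorems.SAWRestrictionRigidityAxiomsOfLimitMarkovMarkovExtension
import Summits.CriticalPhenomena.SAWScalingLimit.Theorems.SAWRestrictionRigidityAxiomsOfLimitMarkovConfigRigidity
import Summits.CriticalPhenomena.SAWScalingLimit.Theorems.SAWRestrictionRigidityAxiomsOfLimitMarkovSlitNotJordan
import Summits.CriticalPhenomena.SAWScalingLimit.Theorems.SAWRestrictionRigidityAxiomsOfLimitMarkovArcComplement
import Summits.CriticalPhenomena.SAWScalingLimit.Theorems.SAWRestrictionRigidityAxiomsOfLimitMarkovSoftMarkov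
import Summits.CriticalPhenomena.SAWScalingLimit.Theorems.SAWRestrictionRigidityAxiomsOfLimitMarkovSoftMarkovPath
import Literature.Probability.RandomPlanarGeometry.SAWScalingLimitFamily
import HarnessLib

/-!
# The domain-Markov extension of every full scaling limit of the critical SAW (given simplicity)

Crux `AxiomsOfLimit` (stmt-CriticalPhenomena-1370), line `registered` (= `split`), stub `stub_markovOfLimit` — the SOFT-MARKOV LINE of
lead c4, final composition. Theorems only.

`isMarkovExtension_of_isScalingLimitFamily`: every chordal family `P` that is the full scaling limit of the critical `δℤ²` SAW
(`SAW.IsScalingLimitFamily P`) and is carried by simple boundary-avoiding curves (conjunct (vi) of the crux, = item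
stmt-CriticalPhenomena-0774) admits a kernel `Q` with `P.IsMarkovExtension Q` — the `initial`, `markov` (ALL Dobrushin domains, ALL
closed stopping sets) and `domain` clauses of the crux's Markov conjunct. NO lattice estimate, NO tip stability, NO restriction
property enters: the kernel is read off the martingale left limits at announceable hitting times (soft-Markov theorem
`stub_softMarkovAllF`, p164411), transported through the clock parametrisation, and made configuration-measurable
(`stub_isMarkovExtensionOfSoft2`, p165752, with configuration rigidity p165839, slit-not-Jordan p165559, arc complement p165488);
the only use of `(lim)` is that `P D` depends on `D` through `(carrier, marked points)` (`IsScalingLimitFamily.apply_eq_of_carrier_eq`).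

What remains of `stub_markovOfLimit` after this file: the RESTRICTION-KERNEL CLAUSE (conditioned into a pinned Jordan sub-domain of the
slit domain the future is `P` there) — research-level (content at cusped sub-domains), see the crux notes.

References: W. Werner (2007) §3.2 (domain Markov property); C. Dellacherie, P.-A. Meyer, *Probabilités et potentiel* B VI.43–45;
F. B. Knight (1975), prediction process. All [folklore].
-/

noncomputable section

open MeasureTheory Filter Topology Set

namespace Summit.CriticalPhenomena.SAWScalingLimit.Theorems.AxiomsOfLimitMarkov

open Literature.Probability.RandomPlanarGeometry

/-- **Domain-Markov extension of simple chordal families with carrier-dependent laws** (all three clauses of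
`ChordalFamily.IsMarkovExtension`): composition of the soft-Markov theorem with the configuration bookkeeping. [folklore] -/
theorem isMarkovExtension_of_isChordal_of_simple (P : ChordalFamily) (hch : P.IsChordal)
    (h6 : ∀ D : DobrushinDomain, ∀ᵐ γ ∂(P D), γ ∈ CurveClass.simple ∧ γ.range ∩ frontier D.carrier ⊆ {D.pt 0, D.pt 1})
    (hdep : ∀ D D' : DobrushinDomain, D.carrier = D'.carrier → D.pt 0 = D'.pt 0 → D.pt 1 = D'.pt 1 → P D = P D') :
    ∃ Q : DobrushinDomain → CurveClass ℂ → Measure (CurveClass ℂ), P.IsMarkovExtension Q :=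
  stub_isMarkovExtensionOfSoft2 (stub_softMarkovAllF stub_softMarkovPathLevel)
    (stub_configRigidity stub_arcComplementConnected) (stub_slitNotJordan stub_arcComplementConnected) P hch h6 hdep

/-- **Domain-Markov extension of every full SAW scaling limit carried by simple boundary-avoiding curves**: for a chordal `P`
with `(lim)` for every Dobrushin domain and every endpoint approximation, and conjunct (vi), there is `Q` with
`P.IsMarkovExtension Q`. [folklore] -/
theorem isMarkovExtension_of_isScalingLimitFamily (P : ChordalFamily) (hch : P.IsChordal)
    (hlim : ∀ (D : DobrushinDomain) (a b : ℝ → Literature.Probability.LatticeModels.Site 2), SAW.IsEndpointApprox D a b →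
      TendstoLaw (fun δ (γ : SAW.DomainSAW D.carrier δ (a δ) (b δ)) => γ.curve)
        (fun δ => SAW.law D.carrier δ (a δ) (b δ)) id (P D))
    (h6 : ∀ D : DobrushinDomain, ∀ᵐ γ ∂(P D), γ ∈ CurveClass.simple ∧ γ.range ∩ frontier D.carrier ⊆ {D.pt 0, D.pt 1}) :
    ∃ Q : DobrushinDomain → CurveClass ℂ → Measure (CurveClass ℂ), P.IsMarkovExtension Q := by
  have hP : SAW.IsScalingLimitFamily P := ⟨hch, hlim⟩
  exact isMarkovExtension_of_isChordal_of_simple P hch h6 fun D D' hc h0 h1 => hP.apply_eq_of_carrier_eq hc h0 h1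

/-- In particular such a limit is **domain Markov** (`ChordalFamily.IsDomainMarkov`). [folklore] -/
theorem isDomainMarkov_of_isScalingLimitFamily (P : ChordalFamily) (hP : SAW.IsScalingLimitFamily P)
    (h6 : ∀ D : DobrushinDomain, ∀ᵐ γ ∂(P D), γ ∈ CurveClass.simple ∧ γ.range ∩ frontier D.carrier ⊆ {D.pt 0, D.pt 1}) :
    P.IsDomainMarkov :=
  isMarkovExtension_of_isScalingLimitFamily P hP.1 hP.2 h6


/-! ### Registered sub-goal of crux stmt-CriticalPhenomena-1370 (line `registered`, stub `stub_markovOfLimit`) -/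

/-- **Registered sub-goal `stub_isMarkovExtensionOfScalingLimit`** (crux stmt-CriticalPhenomena-1370, soft-Markov line, final
composition): the `IsMarkovExtension` half of `stub_markovOfLimit` under the stub's own hypotheses (chordal, `(lim)`, (vi); the
restriction hypothesis is not needed), notation-free. [folklore] -/
theorem stub_isMarkovExtensionOfScalingLimit :
    ∀ P : Literature.Probability.RandomPlanarGeometry.ChordalFamily, P.IsChordal → (∀ (D : Literature.Probability.RandomPlanarGeometry.DobrushinDomain) (a b : ℝ → Literature.Probability.LatticeModels.Site 2), Literature.Probability.RandomPlanarGeometry.SAW.IsEndpointApprox D a b → Literature.Probability.RandomPlanarGeometry.TendstoLaw (fun δ (γ : Literature.Probability.RandomPlanarGeometry.SAW.DomainSAW D.carrier δ (a δ) (b δ)) => γ.curve) (fun δ => Literature.Probability.RandomPlanarGeometry.SAW.law D.carrier δ (a δ) (b δ)) id (P D)) → (∀ D : Literature.Probability.RandomPlanarGeometry.DobrushinDomain, ∀ᵐ γ ∂(P D), γ ∈ Literature.Probability.RandomPlanarGeometry.CurveClass.simple ∧ γ.range ∩ frontier D.carrier ⊆ {D.pt 0, D.pt 1}) → ∃ Q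 : Literature.Probability.RandomPlanarGeometry.DobrushinDomain → Literature.Probability.RandomPlanarGeometry.CurveClass ℂ → MeasureTheory.Measure (Literature.Probability.RandomPlanarGeometry.CurveClass ℂ), P.IsMarkovExtension Q :=
  fun P hch hlim h6 => isMarkovExtension_of_isScalingLimitFamily P hch hlim h6

end Summit.CriticalPhenomena.SAWScalingLimit.Theorems.AxiomsOfLimitMarkov

end
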